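import Mathlib.Analysis.Calculus.ParametricIntervalIntegral
import Mathlib.MeasureTheory.Integral.IntervalIntegral.FundThmCalculus
import Mathlib.Analysis.Calculus.ContDiff.RCLike
import Mathlib.Analysis.Normed.Module.FiniteDimension
import Mathlib.Analysis.Convex.Star
import HarnessLib

/-!
# The Poincaré lemma for vector-valued `1`-forms on open star-shaped sets

Sibling of `PoincareLemmaOneForm` (scalar `1`-forms on a ball).  For a field of continuous
linear maps `A : E → E →L[ℝ] V` (a `V`-valued `1`-form `∑ Aᵢ dxⁱ`, `V` any complete real normed
space) on a finite-dimensional real normed space `E`, *closedness* is the symmetry of the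
derivative, `DA(z)(v)(w) = DA(z)(w)(v)`.  The **Poincaré lemma** in Spivak's form (Spivak,
*Calculus on Manifolds* (1965), Thm. 4-11: "if `A ⊂ ℝⁿ` is an open set star-shaped with respect
to `0`, then every closed form on `A` is exact", with the radial homotopy operator `I`) says that
on an OPEN set `s` STAR-SHAPED with respect to `z₀` such a field is a differential: with

  `u(y) = ∫₀¹ A(z₀ + t (y - z₀)) (y - z₀) dt`

one has `Du(z) = A(z)` for all `z ∈ s`.  This file proves it in Mathlib's Fréchet calculus,
verbatim along the scalar ball case of the sibling file (the only changes: the compact set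
carrying the sup bounds is the cone over a small closed ball at `z` with vertex `z₀`, which lies in
`s` by star-shapedness; and products `t * A(…) w` become scalar actions `t • A(…) w`):

* `hasFDerivAt_radialIntegral_of_starConvex` — `Du(z) = A(z)` for `A` of class `C¹` and closed
  on `s`;
* `contDiffOn_radialIntegral_of_starConvex` / `contDiffOn_one_radialIntegral_of_starConvex` —
  for `A` of class `C^∞` (resp. `C¹`) the potential is `C^∞` (resp. `C¹`);
* `exists_contDiffOn_hasFDerivAt_of_fderiv_symm_of_starConvex` — existence form.

Used for closed invariant `1`-forms on hyperbolic `3`-space `{(z, r) : r > 0}` (a convex open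
half-space, not a ball) with values in a coefficient module (Eichler–Shimura–Harder primitives,
`Literature/NumberTheory/Automorphic/`).  Everything is proved; no definitions, no named facts.

## References

* M. Spivak, *Calculus on Manifolds*, Benjamin 1965, Thm. 4-11 (Poincaré Lemma) and the
  operator `I` before it (p. 94). [`Spivak1965`]
* J. M. Lee, *Introduction to Smooth Manifolds*, 2nd ed., Springer 2013, Thm. 11.49 (Poincaré
  lemma for covector fields on star-shaped open subsets). [`LeeSmoothManifolds2013`]
-/

noncomputable section

open Set Metric MeasureTheory intervalIntegral Filter
open scoped Topology Interval

namespace Literature.Analysis.Calculus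

variable {E : Type*} [NormedAddCommGroup E] [NormedSpace ℝ E]
  {V : Type*} [NormedAddCommGroup V] [NormedSpace ℝ V] [CompleteSpace V]

/-- The cone over the closed ball `closedBall z ε` with vertex `z₀`: the points
`z₀ + t (y - z₀)`, `t ∈ [0, 1]`, `‖y - z‖ ≤ ε`.  In finite dimension it is compact (continuous
image of `[0, 1] × closedBall z ε`). [folklore] -/
theorem isCompact_image_cone [FiniteDimensional ℝ E] (z₀ z : E) (ε : ℝ) :
    IsCompact ((fun p : ℝ × E ↦ z₀ + p.1 • (p.2 - z₀)) '' (Icc (0 : ℝ) 1 ×ˢ closedBall z ε)) :=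
  ((isCompact_Icc).prod (isCompact_closedBall z ε)).image (by fun_prop)

/-- The cone over a closed ball `closedBall z ε ⊆ s` with vertex `z₀` lies in `s` when `s` is
star-shaped with respect to `z₀`. [folklore] -/
theorem image_cone_subset_of_starConvex {s : Set E} {z₀ z : E} {ε : ℝ}
    (hs : StarConvex ℝ z₀ s) (hε : closedBall z ε ⊆ s) :
    (fun p : ℝ × E ↦ z₀ + p.1 • (p.2 - z₀)) '' (Icc (0 : ℝ) 1 ×ˢ closedBall z ε) ⊆ s := by
  rintro _ ⟨⟨t, y⟩, ⟨ht, hy⟩, rfl⟩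
  exact hs.add_smul_sub_mem (hε hy) ht.1 ht.2

/-- Points of the ray from `z₀` to `y ∈ B(z, ε)` at times `t ∈ [0, 1]` lie in the cone over
`closedBall z ε`. [folklore] -/
theorem add_smul_sub_mem_image_cone {z₀ z y : E} {ε t : ℝ} (hy : y ∈ ball z ε)
    (ht : t ∈ Icc (0 : ℝ) 1) :
    z₀ + t • (y - z₀) ∈
      (fun p : ℝ × E ↦ z₀ + p.1 • (p.2 - z₀)) '' (Icc (0 : ℝ) 1 ×ˢ closedBall z ε) :=
  ⟨(t, y), ⟨ht, ball_subset_closedBall hy⟩, rfl⟩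

variable [FiniteDimensional ℝ E]

/-- **The Poincaré lemma for vector-valued `1`-forms on an open star-shaped set (radial homotopy
formula).** Let `A : E → E →L[ℝ] V` be a field of class `C¹` on an open set `s` of a
finite-dimensional real normed space, star-shaped with respect to `z₀`, which is *closed* there —
its derivative is symmetric, `DA(z)(v)(w) = DA(z)(w)(v)`. Then the radial integral
`u(y) = ∫₀¹ A(z₀ + t(y - z₀)) (y - z₀) dt` satisfies `du(z) = A(z)` at every `z ∈ s`.
(Differentiate under the integral sign; by the symmetry of `DA` the integrand of `du(z) w` is
`d/dt [t A(z₀ + t(z - z₀)) w]`.) Spivak, *Calculus on Manifolds* (1965), Thm. 4-11 (Poincaré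
Lemma, star-shaped domains); Lee, *Introduction to Smooth Manifolds*, 2nd ed., Thm. 11.49.
[cite: Spivak1965, Thm. 4-11] -/
theorem hasFDerivAt_radialIntegral_of_starConvex {A : E → E →L[ℝ] V} {z₀ : E} {s : Set E}
    (hso : IsOpen s) (hs : StarConvex ℝ z₀ s) (hA : ContDiffOn ℝ 1 A s)
    (hsymm : ∀ z ∈ s, ∀ v w : E, fderiv ℝ A z v w = fderiv ℝ A z w v)
    {z : E} (hz : z ∈ s) :
    HasFDerivAt (fun y ↦ ∫ t in (0 : ℝ)..1, A (z₀ + t • (y - z₀)) (y - z₀)) (A z) z := by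
  -- a closed ball `closedBall z ε ⊆ s` and the compact cone `K` over it with vertex `z₀`
  obtain ⟨ε, hε0, hεs⟩ := Metric.nhds_basis_closedBall.mem_iff.1 (hso.mem_nhds hz)
  set K := (fun p : ℝ × E ↦ z₀ + p.1 • (p.2 - z₀)) '' (Icc (0 : ℝ) 1 ×ˢ closedBall z ε) with hK
  have hKc : IsCompact K := isCompact_image_cone z₀ z ε
  have hKs : K ⊆ s := image_cone_subset_of_starConvex hs hεs
  have hray : ∀ y ∈ ball z ε, ∀ t ∈ Icc (0 : ℝ) 1, z₀ + t • (y - z₀) ∈ K :=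
    fun y hy t ht ↦ add_smul_sub_mem_image_cone hy ht
  have hzε : z ∈ ball z ε := mem_ball_self hε0
  -- the radius `R` bounding `‖y - z₀‖` for `y ∈ ball z ε`
  set R := ‖z - z₀‖ + ε with hR
  have hyR : ∀ y ∈ ball z ε, ‖y - z₀‖ ≤ R := by
    intro y hy
    rw [mem_ball_iff_norm] at hy
    calc ‖y - z₀‖ = ‖(y - z) + (z - z₀)‖ := by congr 1; abel
      _ ≤ ‖y - z‖ + ‖z - z₀‖ := norm_add_le _ _
      _ ≤ R := by rw [hR]; linarith
  have hR0 : 0 ≤ R := by rw [hR]; positivity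
  -- bounds for `A` and `DA` on the compact cone `K`
  have hAc : ContinuousOn A s := hA.continuousOn
  have hDAc : ContinuousOn (fderiv ℝ A) s := hA.continuousOn_fderiv_of_isOpen hso le_rfl
  obtain ⟨C₀, hC₀⟩ := hKc.exists_bound_of_continuousOn (hAc.mono hKs)
  obtain ⟨C₁, hC₁⟩ := hKc.exists_bound_of_continuousOn
    (f := fun p ↦ (fderiv ℝ A p : E →L[ℝ] E →L[ℝ] V)) (hDAc.mono hKs)
  -- `A` is differentiable at the points of `s`
  have hAd : ∀ p ∈ s, HasFDerivAt A (fderiv ℝ A p) p := fun p hp ↦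
    (((hA.differentiableOn one_ne_zero) p hp).differentiableAt (hso.mem_nhds hp)).hasFDerivAt
  -- the integrand `F` and its derivative `F'` in `y`
  set F : E → ℝ → V := fun y t ↦ A (z₀ + t • (y - z₀)) (y - z₀) with hF
  set F' : E → ℝ → E →L[ℝ] V := fun y t ↦
    t • (fderiv ℝ A (z₀ + t • (y - z₀))).flip (y - z₀) + A (z₀ + t • (y - z₀)) with hF'
  -- (1) pointwise differentiability in `y`
  have hdiff : ∀ t ∈ Icc (0 : ℝ) 1, ∀ y ∈ ball z ε, HasFDerivAt (fun y ↦ F y t) (F' y t) y := by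
    intro t ht y hy
    have hγ : HasFDerivAt (fun y : E ↦ z₀ + t • (y - z₀)) (t • ContinuousLinearMap.id ℝ E) y := by
      have h1 : HasFDerivAt (fun y : E ↦ y - z₀) (ContinuousLinearMap.id ℝ E) y :=
        (hasFDerivAt_id y).sub_const z₀
      exact (h1.const_smul t).const_add z₀
    have hAγ : HasFDerivAt (fun y : E ↦ A (z₀ + t • (y - z₀)))
        ((fderiv ℝ A (z₀ + t • (y - z₀))).comp (t • ContinuousLinearMap.id ℝ E)) y :=
      (hAd _ (hKs (hray y hy t ht))).comp y hγ
    have hu : HasFDerivAt (fun y : E ↦ y - z₀) (ContinuousLinearMap.id ℝ E) y :=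
      (hasFDerivAt_id y).sub_const z₀
    have h := hAγ.clm_apply hu
    refine h.congr_fderiv ?_
    ext w
    simp only [hF', add_apply, smul_apply,
      ContinuousLinearMap.flip_apply, ContinuousLinearMap.comp_apply,
      ContinuousLinearMap.id_apply, map_smul]
    abel
  -- (2) continuity in `t` on `[0, 1]` of `F y` (`y` near `z`) and of `F' z`
  have hγc : ∀ y, Continuous (fun t : ℝ ↦ z₀ + t • (y - z₀)) := fun y ↦ by fun_prop
  have hγmaps : ∀ y ∈ ball z ε, MapsTo (fun t : ℝ ↦ z₀ + t • (y - z₀)) (Icc 0 1) s :=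
    fun y hy t ht ↦ hKs (hray y hy t ht)
  have hFc : ∀ y ∈ ball z ε, ContinuousOn (F y) (Icc 0 1) := by
    intro y hy
    have h1 : ContinuousOn (fun t : ℝ ↦ A (z₀ + t • (y - z₀))) (Icc 0 1) :=
      hAc.comp (hγc y).continuousOn (hγmaps y hy)
    exact h1.clm_apply continuousOn_const
  have hF'c : ContinuousOn (F' z) (Icc 0 1) := by
    have h1 : ContinuousOn (fun t : ℝ ↦ A (z₀ + t • (z - z₀))) (Icc 0 1) :=
      hAc.comp (hγc z).continuousOn (hγmaps z hzε)
    have h2 : ContinuousOn (fun t : ℝ ↦ fderiv ℝ A (z₀ + t • (z - z₀))) (Icc 0 1) :=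
      hDAc.comp (hγc z).continuousOn (hγmaps z hzε)
    have h3 : ContinuousOn (fun t : ℝ ↦ (fderiv ℝ A (z₀ + t • (z - z₀))).flip (z - z₀))
        (Icc 0 1) :=
      ((ContinuousLinearMap.flipₗᵢ ℝ E E V).continuous.comp_continuousOn h2).clm_apply
        continuousOn_const
    exact (continuousOn_id.smul h3).add h1
  have hIoc : Ι (0 : ℝ) 1 ⊆ Icc 0 1 := by
    rw [uIoc_of_le zero_le_one]; exact Ioc_subset_Icc_self
  -- (3) differentiate under the integral sign
  have hmain : HasFDerivAt (fun y ↦ ∫ t in (0 : ℝ)..1, F y t) (∫ t in (0 : ℝ)..1, F' z t) z := by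
    refine hasFDerivAt_integral_of_dominated_of_fderiv_le (μ := volume)
      (bound := fun _ ↦ (max C₁ 0) * R + C₀) (isOpen_ball.mem_nhds hzε) ?_ ?_ ?_ ?_ ?_ ?_
    · filter_upwards [isOpen_ball.mem_nhds hzε] with y hy
      exact ((hFc y hy).mono hIoc).aestronglyMeasurable measurableSet_uIoc
    · exact ((hFc z hzε).mono (by rw [uIcc_of_le zero_le_one])).intervalIntegrable
    · exact (hF'c.mono hIoc).aestronglyMeasurable measurableSet_uIoc
    · refine ae_of_all _ fun t ht y hy ↦ ?_
      have ht' : t ∈ Icc (0 : ℝ) 1 := hIoc ht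
      have hγK : z₀ + t • (y - z₀) ∈ K := hray y hy t ht'
      calc ‖F' y t‖ ≤ ‖t • (fderiv ℝ A (z₀ + t • (y - z₀))).flip (y - z₀)‖ +
            ‖A (z₀ + t • (y - z₀))‖ := norm_add_le _ _
        _ ≤ 1 * ((max C₁ 0) * R) + C₀ := by
          gcongr
          · rw [norm_smul, Real.norm_eq_abs]
            gcongr
            · exact abs_le.2 ⟨by linarith [ht'.1], ht'.2⟩
            · calc ‖(fderiv ℝ A (z₀ + t • (y - z₀))).flip (y - z₀)‖
                  ≤ ‖(fderiv ℝ A (z₀ + t • (y - z₀))).flip‖ * ‖y - z₀‖ :=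
                    ContinuousLinearMap.le_opNorm _ _
                _ ≤ (max C₁ 0) * R := by
                    rw [ContinuousLinearMap.opNorm_flip]
                    exact mul_le_mul ((hC₁ _ hγK).trans (le_max_left _ _)) (hyR y hy)
                      (norm_nonneg _) (le_max_right _ _)
          · exact hC₀ _ hγK
        _ = (max C₁ 0) * R + C₀ := by ring
    · exact intervalIntegrable_const
    · exact ae_of_all _ fun t ht y hy ↦ hdiff t (hIoc ht) y hy
  -- (4) the derivative is `A z`: `∫₀¹ F'(z, t) w dt = ∫₀¹ d/dt (t • A(z₀ + t(z - z₀)) w) dt = A(z) w`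
  have hint : IntervalIntegrable (F' z) volume 0 1 :=
    (hF'c.mono (by rw [uIcc_of_le zero_le_one])).intervalIntegrable
  have key : ∫ t in (0 : ℝ)..1, F' z t = A z := by
    apply ContinuousLinearMap.ext
    intro w
    rw [ContinuousLinearMap.intervalIntegral_apply hint w]
    have hφ : ∀ t ∈ uIcc (0 : ℝ) 1,
        HasDerivAt (fun t : ℝ ↦ t • A (z₀ + t • (z - z₀)) w) (F' z t w) t := by
      intro t ht
      rw [uIcc_of_le zero_le_one] at ht
      have hmem : z₀ + t • (z - z₀) ∈ s := hKs (hray z hzε t ht)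
      have hγ' : HasDerivAt (fun t : ℝ ↦ z₀ + t • (z - z₀)) (z - z₀) t := by
        simpa using ((hasDerivAt_id t).smul_const (z - z₀)).const_add z₀
      have hAγ : HasDerivAt (fun t : ℝ ↦ A (z₀ + t • (z - z₀)))
          (fderiv ℝ A (z₀ + t • (z - z₀)) (z - z₀)) t :=
        (hAd _ hmem).comp_hasDerivAt t hγ'
      have hAw : HasDerivAt (fun t : ℝ ↦ A (z₀ + t • (z - z₀)) w)
          (fderiv ℝ A (z₀ + t • (z - z₀)) (z - z₀) w) t := by
        simpa using hAγ.clm_apply (hasDerivAt_const t w)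
      have h := (hasDerivAt_id t).smul hAw
      refine h.congr_deriv ?_
      simp only [hF', add_apply, smul_apply,
        ContinuousLinearMap.flip_apply, id, hsymm _ hmem (z - z₀) w, one_smul]
    have hint' : IntervalIntegrable (fun t ↦ F' z t w) volume 0 1 :=
      ((hF'c.clm_apply continuousOn_const).mono (by rw [uIcc_of_le zero_le_one])).intervalIntegrable
    rw [integral_eq_sub_of_hasDerivAt hφ hint']
    simp
  rw [key] at hmain
  exact hmain

open scoped ContDiff in
/-- **Smooth potentials.** If the closed field `A` is `C^∞` on the open star-shaped set `s`, its
radial integral `u` is `C^∞` there, with `Du = A` (a function with `C^∞` derivative is `C^∞`,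
`contDiffOn_infty_iff_fderiv_of_isOpen`). Spivak 1965, Thm. 4-11. [cite: Spivak1965, Thm. 4-11] -/
theorem contDiffOn_radialIntegral_of_starConvex {A : E → E →L[ℝ] V} {z₀ : E} {s : Set E}
    (hso : IsOpen s) (hs : StarConvex ℝ z₀ s) (hA : ContDiffOn ℝ ∞ A s)
    (hsymm : ∀ z ∈ s, ∀ v w : E, fderiv ℝ A z v w = fderiv ℝ A z w v) :
    ContDiffOn ℝ ∞ (fun y ↦ ∫ t in (0 : ℝ)..1, A (z₀ + t • (y - z₀)) (y - z₀)) s := by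
  have hA1 : ContDiffOn ℝ 1 A s := hA.of_le (by exact_mod_cast le_top)
  have hd := fun z (hz : z ∈ s) ↦ hasFDerivAt_radialIntegral_of_starConvex hso hs hA1 hsymm hz
  rw [contDiffOn_infty_iff_fderiv_of_isOpen hso]
  exact ⟨fun z hz ↦ (hd z hz).differentiableAt.differentiableWithinAt,
    hA.congr fun z hz ↦ (hd z hz).fderiv⟩

/-- **`C¹` potentials.** If the closed field `A` is `C¹` on the open star-shaped set `s`, its
radial integral `u` is `C¹` there (its derivative `A` is continuous). Spivak 1965, Thm. 4-11.
[cite: Spivak1965, Thm. 4-11] -/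
theorem contDiffOn_one_radialIntegral_of_starConvex {A : E → E →L[ℝ] V} {z₀ : E} {s : Set E}
    (hso : IsOpen s) (hs : StarConvex ℝ z₀ s) (hA : ContDiffOn ℝ 1 A s)
    (hsymm : ∀ z ∈ s, ∀ v w : E, fderiv ℝ A z v w = fderiv ℝ A z w v) :
    ContDiffOn ℝ 1 (fun y ↦ ∫ t in (0 : ℝ)..1, A (z₀ + t • (y - z₀)) (y - z₀)) s := by
  have hd := fun z (hz : z ∈ s) ↦ hasFDerivAt_radialIntegral_of_starConvex hso hs hA hsymm hz
  rw [show (1 : WithTop ℕ∞) = 0 + 1 from rfl, contDiffOn_succ_iff_fderiv_of_isOpen hso]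
  refine ⟨fun z hz ↦ (hd z hz).differentiableAt.differentiableWithinAt, by simp, ?_⟩
  exact (contDiffOn_zero.2 hA.continuousOn).congr fun z hz ↦ (hd z hz).fderiv

open scoped ContDiff in
/-- **The Poincaré lemma for vector-valued `1`-forms, existence form**: a `C^∞` field
`A : E → E →L[ℝ] V` with symmetric derivative on an open star-shaped subset `s` of a
finite-dimensional real normed space is the differential of a `C^∞` function on `s`.
Spivak 1965, Thm. 4-11; Lee, *Introduction to Smooth Manifolds*, 2nd ed., Thm. 11.49.
[cite: Spivak1965, Thm. 4-11] -/
theorem exists_contDiffOn_hasFDerivAt_of_fderiv_symm_of_starConvex {A : E → E →L[ℝ] V}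
    {z₀ : E} {s : Set E} (hso : IsOpen s) (hs : StarConvex ℝ z₀ s) (hA : ContDiffOn ℝ ∞ A s)
    (hsymm : ∀ z ∈ s, ∀ v w : E, fderiv ℝ A z v w = fderiv ℝ A z w v) :
    ∃ u : E → V, ContDiffOn ℝ ∞ u s ∧ ∀ z ∈ s, HasFDerivAt u (A z) z :=
  ⟨_, contDiffOn_radialIntegral_of_starConvex hso hs hA hsymm, fun _ hz ↦
    hasFDerivAt_radialIntegral_of_starConvex hso hs (hA.of_le (by exact_mod_cast le_top)) hsymm hz⟩

/-- **The Poincaré lemma, `C¹` existence form**: a `C¹` field `A : E → E →L[ℝ] V` with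
symmetric derivative on an open star-shaped subset `s` of a finite-dimensional real normed space
is the differential of a `C¹` function on `s`. Spivak 1965, Thm. 4-11. [cite: Spivak1965, Thm. 4-11] -/
theorem exists_contDiffOn_one_hasFDerivAt_of_fderiv_symm_of_starConvex {A : E → E →L[ℝ] V}
    {z₀ : E} {s : Set E} (hso : IsOpen s) (hs : StarConvex ℝ z₀ s) (hA : ContDiffOn ℝ 1 A s)
    (hsymm : ∀ z ∈ s, ∀ v w : E, fderiv ℝ A z v w = fderiv ℝ A z w v) :
    ∃ u : E → V, ContDiffOn ℝ 1 u s ∧ ∀ z ∈ s, HasFDerivAt u (A z) z :=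
  ⟨_, contDiffOn_one_radialIntegral_of_starConvex hso hs hA hsymm, fun _ hz ↦
    hasFDerivAt_radialIntegral_of_starConvex hso hs hA hsymm hz⟩

end Literature.Analysis.Calculus

end
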